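import Literature.Analysis.FunctionSpaces.TorusFourierCalculus
import Mathlib.Analysis.Normed.Module.FiniteDimension
import Mathlib.Analysis.Normed.Group.Tannery
import Mathlib.MeasureTheory.Group.Integral
import Mathlib.MeasureTheory.Measure.OpenPos
import Mathlib.MeasureTheory.Function.L2Space
import HarnessLib

/-!
# Bounded `L²` functions on the torus: trigonometric approximation with sup-norm control

Analysis/FunctionSpaces support file (everything proved; no definitions, no named facts). Convention:
Mathlib's `AddCircleMulti` one — the measure on `ℝ/ℤ` is the Haar PROBABILITY measure
(`local instance`), so that `Lp ℂ 2 volume` on `UnitAddTorus d` is the space carrying Mathlib's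
Hilbert basis `UnitAddTorus.mFourierBasis` (as in `Literature/…/QuantumManyBody/PeriodicFormDomain`).

Main result (`HaarTorus.exists_trigPoly_approx_of_bound`): if `f ∈ L²(T^d)` satisfies `‖f‖ ≤ C`
a.e., then for every `ε > 0` there are a box `B_R = [-R, R]^d ⊆ ℤ^d` and a multiplier
`m : ℤ^d → ℂ` with `|m| ≤ 1`, invariant under all coordinate permutations of `d`, such that the
trigonometric polynomial `P = ∑_{n ∈ B_R} m(n) f̂(n) e_n` satisfies

  `sup |P| ≤ C + ε`  and  `‖P - f‖_{L²} ≤ ε`.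

So bounded functions are `L²`-limits of trigonometric polynomials with essentially the same sup
bound whose coefficients are dominated by those of `f` (hence every spectral Sobolev seminorm of
`P` is at most that of `f`) and inherit every coordinate-permutation symmetry of `f̂`. This is the
classical smoothing step "convolve with a positive approximate identity, then truncate the
(absolutely convergent) Fourier series" (Grafakos 2014, Thm. 3.1.6 / Prop. 3.1.10 with the box
kernel `|B_h|⁻¹ 1_{B_h}` in place of the Fejér kernel; Katznelson, *Harmonic Analysis*, I.2.11):
`m = m_h` is the Fourier multiplier `n ↦ ∫ K_h e_n` of the normalised indicator `K_h` of the
sup-metric ball of radius `h`; `|m_h| ≤ 1`, `m_h(n) → 1` (`h → 0`), the averaged function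
`∫ K_h(y - x) f(y) dy` is bounded by `C` everywhere and equals `∑ₙ e_n(x) m_h(n) f̂(n)` everywhere
(Parseval for `⟪K_h(· - x), f⟫`), the series converging absolutely; Tannery's theorem in `n`
makes `∑ₙ |m_h(n) - 1|² |f̂(n)|²` small, and the box is then chosen beyond both tails.

Also recorded: the general positive-kernel facts behind it (`norm_integral_kernel_mul_le`,
`hasSum_kernel_average`, `norm_kernelMultiplier_sub_one_le`, `kernelMultiplier_comp_perm`), the
Fourier coefficients / a.e. representative / Parseval norm of finite Fourier sums in `L²`, and the
permutation invariance of the boxes `B_R`.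

## Mathlib / tree search

Mathlib: `UnitAddTorus.mFourierBasis`, `hasSum_sq_mFourierCoeff`, `HilbertBasis.hasSum_inner_mul_inner`,
`tendsto_tsum_of_dominated_convergence` (Tannery), `summable_norm_iff` (finite dimension),
`Orthonormal.inner_right_sum`; no convolution / approximate identity on `UnitAddTorus` in the Haar
convention. Tree (global-`volume` `Torus` convention, smooth data): `TorusConvolution`,
`TorusApproximateIdentity`, `TorusFourierSeries` (uniform convergence for SMOOTH fields),
`TorusHeatKernel` (positivity of the heat kernel) — none gives sup-norm control for merely bounded
`L²` data; `Torus.mFourier_apply_add` (`TorusFourierCalculus`) is reused.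

## References

* L. Grafakos, *Classical Fourier Analysis*, 3rd ed., GTM 249 (2014), §3.1.2–3.1.3 (approximate
  identities on `𝕋ⁿ`, Thm. 3.1.6, Prop. 3.1.10), Prop. 3.2.7 (Parseval).
* Y. Katznelson, *An Introduction to Harmonic Analysis*, 3rd ed. (2004), Ch. I §2 (summability
  kernels; `‖K ⋆ f‖_∞ ≤ ‖f‖_∞`).
-/

noncomputable section

open MeasureTheory Set Filter Topology UnitAddTorus Metric
open scoped ENNReal NNReal InnerProductSpace ComplexConjugate

namespace Literature.Analysis.FunctionSpaces

namespace HaarTorus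

/-- Mathlib's `AddCircleMulti` convention: the measure on `ℝ/ℤ` is the Haar probability measure
(local instance, definitionally the one of `Mathlib.Analysis.Fourier.AddCircleMulti` and of
`Literature/MathematicalPhysics/QuantumManyBody/PeriodicFormDomain`). [folklore] -/
local instance haarCircle_measureSpace : MeasureSpace UnitAddCircle := ⟨AddCircle.haarAddCircle⟩

/-- The measure on `ℝ/ℤ` is a Haar measure. [folklore] -/
local instance haarCircle_isAddHaarMeasure : Measure.IsAddHaarMeasure (volume : Measure UnitAddCircle) :=
  inferInstanceAs (Measure.IsAddHaarMeasure AddCircle.haarAddCircle)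

/-- The measure on `ℝ/ℤ` is a probability measure. [folklore] -/
local instance haarCircle_isProbabilityMeasure : IsProbabilityMeasure (volume : Measure UnitAddCircle) :=
  inferInstanceAs (IsProbabilityMeasure AddCircle.haarAddCircle)

variable {d : Type*} [Fintype d]

/-- The measure on `(ℝ/ℤ)^d` is a probability measure. [folklore] -/
local instance haarTorus_isProbabilityMeasure : IsProbabilityMeasure (volume : Measure (UnitAddTorus d)) := by
  rw [volume_pi]; infer_instance

/-- The measure on `(ℝ/ℤ)^d` is left invariant. [folklore] -/
local instance haarTorus_isAddLeftInvariant : (volume : Measure (UnitAddTorus d)).IsAddLeftInvariant := by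
  rw [volume_pi]; infer_instance

/-- The measure on `(ℝ/ℤ)^d` is right invariant. [folklore] -/
local instance haarTorus_isAddRightInvariant : (volume : Measure (UnitAddTorus d)).IsAddRightInvariant := by
  rw [volume_pi]; infer_instance

/-- The measure on `(ℝ/ℤ)^d` charges open sets. [folklore] -/
local instance haarTorus_isOpenPosMeasure : (volume : Measure (UnitAddTorus d)).IsOpenPosMeasure := by
  rw [volume_pi]; infer_instance

/-! ## Characters -/

/-- `e_n(0) = 1`. [folklore] -/
theorem mFourier_apply_zero (n : d → ℤ) : mFourier n (0 : UnitAddTorus d) = 1 := by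
  simp [mFourier]

/-- For every `ε > 0` the character `e_n` is `ε`-close to `1` on a small ball around `0`. [folklore] -/
theorem exists_norm_mFourier_sub_one_le (n : d → ℤ) {ε : ℝ} (hε : 0 < ε) :
    ∃ δ > 0, ∀ z : UnitAddTorus d, ‖z‖ < δ → ‖mFourier n z - 1‖ ≤ ε := by
  have h := (mFourier n).continuous.tendsto (0 : UnitAddTorus d)
  rw [mFourier_apply_zero] at h
  obtain ⟨δ, hδ, hball⟩ := Metric.eventually_nhds_iff.1 (h (Metric.closedBall_mem_nhds (1 : ℂ) hε))
  refine ⟨δ, hδ, fun z hz => ?_⟩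
  have := hball (by rwa [dist_zero_right])
  rwa [mem_closedBall, dist_eq_norm] at this

/-- Permuting the coordinates of the argument permutes the frequency: `e_n(z ∘ σ) = e_{n ∘ σ⁻¹}(z)`.
[folklore] -/
theorem mFourier_comp_perm (n : d → ℤ) (σ : Equiv.Perm d) (z : UnitAddTorus d) :
    mFourier n (fun i => z (σ i)) = mFourier (fun i => n (σ.symm i)) z := by
  simp only [mFourier, ContinuousMap.coe_mk]
  exact Fintype.prod_equiv σ _ _ fun i => by simp

/-- The sup norm of `(ℝ/ℤ)^d` is invariant under coordinate permutations. [folklore] -/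
theorem norm_comp_perm (z : UnitAddTorus d) (σ : Equiv.Perm d) : ‖(fun i => z (σ i))‖ = ‖z‖ := by
  refine le_antisymm ((pi_norm_le_iff_of_nonneg (norm_nonneg z)).2 fun i => norm_le_pi_norm z (σ i))
    ((pi_norm_le_iff_of_nonneg (norm_nonneg _)).2 fun i => ?_)
  have h := norm_le_pi_norm (fun i => z (σ i)) (σ.symm i)
  rwa [Equiv.apply_symm_apply] at h

/-- The coordinate permutation `z ↦ z ∘ σ` preserves the Haar product measure. [folklore] -/
theorem measurePreserving_arrowCongr'_perm (σ : Equiv.Perm d) :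
    MeasurePreserving (MeasurableEquiv.arrowCongr' σ.symm (MeasurableEquiv.refl UnitAddCircle))
      (volume : Measure (UnitAddTorus d)) volume := by
  rw [volume_pi]
  exact measurePreserving_arrowCongr' _ _ _ _ fun _ => MeasurePreserving.id _

omit [Fintype d] in
/-- Pointwise form of the coordinate permutation. [folklore] -/
theorem arrowCongr'_perm_apply (σ : Equiv.Perm d) (z : UnitAddTorus d) (i : d) :
    MeasurableEquiv.arrowCongr' σ.symm (MeasurableEquiv.refl UnitAddCircle) z i = z (σ i) := rfl

/-! ## Positive kernels: sup bound, multiplier, pointwise Fourier series -/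

section Kernel

variable {K : UnitAddTorus d → ℝ}

/-- A bounded measurable kernel is integrable. [folklore] -/
theorem integrable_kernel (hKm : Measurable K) {B : ℝ} (hKb : ∀ z, |K z| ≤ B) : Integrable K volume :=
  (memLp_top_of_bound hKm.aestronglyMeasurable B (Eventually.of_forall fun z => by
    rw [Real.norm_eq_abs]; exact hKb z)).integrable le_top

/-- The complexified translated kernel `y ↦ K(y - x)` is in `L²`. [folklore] -/
theorem memLp_kernel_translate (hKm : Measurable K) {B : ℝ} (hKb : ∀ z, |K z| ≤ B) (x : UnitAddTorus d) :
    MemLp (fun y => (K (y - x) : ℂ)) 2 (volume : Measure (UnitAddTorus d)) :=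
  MemLp.of_bound (Complex.continuous_ofReal.measurable.comp (hKm.comp (measurable_sub_const x))).aestronglyMeasurable
    B (Eventually.of_forall fun y => by rw [Complex.norm_real, Real.norm_eq_abs]; exact hKb _)

/-- The multiplier of a kernel of unit mass has modulus at most `∫ |K|`; for `K ≥ 0`, `∫ K = 1` this
is `≤ 1`. [folklore] -/
theorem norm_kernelMultiplier_le_one (hK0 : ∀ z, 0 ≤ K z) (hK1 : ∫ z, K z = 1) (n : d → ℤ) :
    ‖∫ z, (K z : ℂ) * mFourier n z‖ ≤ 1 := by
  refine (norm_integral_le_integral_norm _).trans (le_of_eq ?_)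
  calc ∫ z, ‖(K z : ℂ) * mFourier n z‖ = ∫ z, K z := by
        refine integral_congr_ae (Eventually.of_forall fun z => ?_)
        simp only [norm_mul, Complex.norm_real, Real.norm_eq_abs, abs_of_nonneg (hK0 z)]
        have : ‖mFourier n z‖ = 1 := by simp [mFourier]
        rw [this, mul_one]
    _ = 1 := hK1

/-- If `K ≥ 0` has unit mass, vanishes off the ball `‖z‖ ≤ ρ`, and `‖e_n - 1‖ ≤ ε` on that ball, then
the multiplier is `ε`-close to `1`: `‖∫ K e_n - 1‖ ≤ ε`. [folklore] -/
theorem norm_kernelMultiplier_sub_one_le (hK0 : ∀ z, 0 ≤ K z) (hKm : Measurable K) {B : ℝ}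
    (hKb : ∀ z, |K z| ≤ B) (hK1 : ∫ z, K z = 1) {n : d → ℤ} {ε ρ : ℝ}
    (hn : ∀ z : UnitAddTorus d, ‖z‖ ≤ ρ → ‖mFourier n z - 1‖ ≤ ε)
    (hsupp : ∀ z, ρ < ‖z‖ → K z = 0) :
    ‖(∫ z, (K z : ℂ) * mFourier n z) - 1‖ ≤ ε := by
  have hKi : Integrable K volume := integrable_kernel hKm hKb
  have hKi' : Integrable (fun z => (K z : ℂ)) volume := hKi.ofReal
  have hint : ∀ m : d → ℤ, Integrable (fun z => (K z : ℂ) * mFourier m z) volume := fun m =>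
    hKi'.mul_bdd (mFourier m).continuous.aestronglyMeasurable
      (Eventually.of_forall fun z => show ‖mFourier m z‖ ≤ 1 from le_of_eq (by simp [mFourier]))
  have h1 : ∫ z, (K z : ℂ) * (mFourier n z - 1) = (∫ z, (K z : ℂ) * mFourier n z) - 1 := by
    simp only [mul_sub, mul_one]
    rw [integral_sub (hint n) hKi', integral_complex_ofReal, hK1, Complex.ofReal_one]
  rw [← h1]
  refine (norm_integral_le_integral_norm _).trans ?_
  calc ∫ z, ‖(K z : ℂ) * (mFourier n z - 1)‖ ≤ ∫ z, K z * ε := by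
        refine integral_mono_of_nonneg (Eventually.of_forall fun z => norm_nonneg _) (hKi.mul_const ε)
          (Eventually.of_forall fun z => ?_)
        dsimp only
        rw [norm_mul, Complex.norm_real, Real.norm_eq_abs, abs_of_nonneg (hK0 z)]
        rcases le_or_gt ‖z‖ ρ with hz | hz
        · exact mul_le_mul_of_nonneg_left (hn z hz) (hK0 z)
        · rw [hsupp z hz, zero_mul, zero_mul]
    _ = ε := by rw [integral_mul_const, hK1, one_mul]

/-- The multiplier of a kernel invariant under coordinate permutations is invariant:
`m_K(n ∘ σ) = m_K(n)`. [folklore] -/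
theorem kernelMultiplier_comp_perm {σ : Equiv.Perm d} (hKσ : ∀ z : UnitAddTorus d, K (fun i => z (σ i)) = K z)
    (n : d → ℤ) :
    ∫ z, (K z : ℂ) * mFourier (fun i => n (σ i)) z = ∫ z, (K z : ℂ) * mFourier n z := by
  have h := (measurePreserving_arrowCongr'_perm (d := d) σ).integral_comp'
    (g := fun z => (K z : ℂ) * mFourier (fun i => n (σ i)) z)
  rw [← h]
  refine integral_congr_ae (Eventually.of_forall fun z => ?_)
  have hz : (MeasurableEquiv.arrowCongr' σ.symm (MeasurableEquiv.refl UnitAddCircle) z : UnitAddTorus d) =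
      fun i => z (σ i) := funext fun i => arrowCongr'_perm_apply σ z i
  dsimp only
  rw [hz, hKσ, mFourier_comp_perm]
  simp only [Equiv.apply_symm_apply]

/-- **Sup bound**: if `K ≥ 0`, `∫ K = 1` and `‖f‖ ≤ C` a.e., then `‖∫ K(y - x) f(y) dy‖ ≤ C` for EVERY
`x`. [cite: Katznelson2004, Ch. I §2] -/
theorem norm_integral_kernel_mul_le (hK0 : ∀ z, 0 ≤ K z) (hKm : Measurable K) {B : ℝ}
    (hKb : ∀ z, |K z| ≤ B) (hK1 : ∫ z, K z = 1) (f : Lp ℂ 2 (volume : Measure (UnitAddTorus d)))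
    {C : ℝ} (hC : ∀ᵐ y ∂volume, ‖f y‖ ≤ C) (x : UnitAddTorus d) :
    ‖∫ y, (K (y - x) : ℂ) * f y‖ ≤ C := by
  have hfi : Integrable f volume := (Lp.memLp f).integrable one_le_two
  have hKi : Integrable K volume := integrable_kernel hKm hKb
  have hKx : Integrable (fun y => K (y - x)) volume := hKi.comp_sub_right x
  calc ‖∫ y, (K (y - x) : ℂ) * f y‖ ≤ ∫ y, ‖(K (y - x) : ℂ) * f y‖ := norm_integral_le_integral_norm _
    _ ≤ ∫ y, K (y - x) * C := by
        refine integral_mono_of_nonneg (Eventually.of_forall fun y => norm_nonneg _) (hKx.mul_const C)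
          (hC.mono fun y hy => ?_)
        dsimp only
        rw [norm_mul, Complex.norm_real, Real.norm_eq_abs, abs_of_nonneg (hK0 _)]
        exact mul_le_mul_of_nonneg_left hy (hK0 _)
    _ = C := by rw [integral_mul_const, integral_sub_right_eq_self _ x, hK1, one_mul]

/-- The inner products against the Hilbert basis are the Fourier coefficients. [folklore] -/
theorem inner_mFourierLp_eq_mFourierCoeff (f : Lp ℂ 2 (volume : Measure (UnitAddTorus d))) (n : d → ℤ) :
    ⟪(mFourierLp 2 n : Lp ℂ 2 (volume : Measure (UnitAddTorus d))), f⟫_ℂ = mFourierCoeff f n := by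
  rw [← coe_mFourierBasis, ← mFourierBasis.repr_apply_apply, mFourierBasis_repr]

/-- **The kernel average is its Fourier series, everywhere**: for bounded measurable `K` and
`f ∈ L²`, `∫ K(y - x) f(y) dy = ∑ₙ e_n(x) (∫ K e_n) f̂(n)` at every `x`, as a `HasSum`
(Parseval for `⟪K(· - x), f⟫`). [cite: Grafakos2014, Prop. 3.2.7] -/
theorem hasSum_kernel_average (hKm : Measurable K) {B : ℝ} (hKb : ∀ z, |K z| ≤ B)
    (f : Lp ℂ 2 (volume : Measure (UnitAddTorus d))) (x : UnitAddTorus d) :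
    HasSum (fun n : d → ℤ => (mFourier n x * ∫ z, (K z : ℂ) * mFourier n z) * mFourierCoeff f n)
      (∫ y, (K (y - x) : ℂ) * f y) := by
  have hkx := memLp_kernel_translate hKm hKb x
  -- `⟪K(· - x), f⟫ = ∫ K(y - x) f(y) dy`
  have h1 : ⟪hkx.toLp _, f⟫_ℂ = ∫ y, (K (y - x) : ℂ) * f y := by
    rw [MeasureTheory.L2.inner_def]
    refine integral_congr_ae (hkx.coeFn_toLp.mono fun y hy => ?_)
    dsimp only at hy ⊢
    rw [hy, RCLike.inner_apply', Complex.conj_ofReal]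
  -- `⟪K(· - x), e_n⟫ = e_n(x) ∫ K e_n`
  have h2 : ∀ n : d → ℤ, ⟪hkx.toLp _, (mFourierLp 2 n : Lp ℂ 2 (volume : Measure (UnitAddTorus d)))⟫_ℂ =
      mFourier n x * ∫ z, (K z : ℂ) * mFourier n z := by
    intro n
    rw [MeasureTheory.L2.inner_def]
    calc ∫ y, ⟪hkx.toLp _ y, (mFourierLp 2 n : Lp ℂ 2 (volume : Measure (UnitAddTorus d))) y⟫_ℂ
        = ∫ y, (K (y - x) : ℂ) * mFourier n y := by
          refine integral_congr_ae ?_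
          filter_upwards [hkx.coeFn_toLp, coeFn_mFourierLp 2 n] with y hy hy'
          rw [hy, hy', RCLike.inner_apply', Complex.conj_ofReal]
      _ = ∫ z, (K z : ℂ) * mFourier n (z + x) := by
          rw [← integral_add_right_eq_self (fun y => (K (y - x) : ℂ) * mFourier n y) x]
          simp only [add_sub_cancel_right]
      _ = mFourier n x * ∫ z, (K z : ℂ) * mFourier n z := by
          rw [← integral_const_mul]
          refine integral_congr_ae (Eventually.of_forall fun z => ?_)
          dsimp only
          rw [Torus.mFourier_apply_add]
          ring
  have h3 := mFourierBasis.hasSum_inner_mul_inner (hkx.toLp _) f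
  simp only [coe_mFourierBasis, h2, inner_mFourierLp_eq_mFourierCoeff, h1] at h3
  exact h3

/-- The terms of the pointwise series are absolutely summable (unconditional convergence in `ℂ`),
with `‖e_n(x) m(n) f̂(n)‖ = ‖m(n) f̂(n)‖`. [folklore] -/
theorem summable_norm_kernelMultiplier_mul (hKm : Measurable K) {B : ℝ} (hKb : ∀ z, |K z| ≤ B)
    (f : Lp ℂ 2 (volume : Measure (UnitAddTorus d))) :
    Summable fun n : d → ℤ => ‖(∫ z, (K z : ℂ) * mFourier n z) * mFourierCoeff f n‖ := by
  have h := summable_norm_iff.2 (hasSum_kernel_average hKm hKb f 0).summable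
  refine h.congr fun n => ?_
  rw [mFourier_apply_zero, one_mul]

end Kernel

/-! ## Finite Fourier sums in `L²` -/

/-- Fourier coefficients of a finite Fourier sum. [folklore] -/
theorem inner_mFourierLp_sum_smul (S : Finset (d → ℤ)) (b : (d → ℤ) → ℂ) (n : d → ℤ) :
    ⟪(mFourierLp 2 n : Lp ℂ 2 (volume : Measure (UnitAddTorus d))),
      ∑ m ∈ S, b m • (mFourierLp 2 m : Lp ℂ 2 (volume : Measure (UnitAddTorus d)))⟫_ℂ =
      if n ∈ S then b n else 0 := by
  classical
  split_ifs with hn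
  · exact orthonormal_mFourier.inner_right_sum b hn
  · rw [inner_sum]
    refine Finset.sum_eq_zero fun m hm => ?_
    rw [inner_smul_right, orthonormal_iff_ite.1 orthonormal_mFourier, if_neg (show ¬ n = m from fun h => hn (h ▸ hm)),
      mul_zero]

/-- The a.e. representative of a finite Fourier sum is the trigonometric polynomial. [folklore] -/
theorem coeFn_sum_smul_mFourierLp (S : Finset (d → ℤ)) (b : (d → ℤ) → ℂ) :
    ((∑ m ∈ S, b m • (mFourierLp 2 m : Lp ℂ 2 (volume : Measure (UnitAddTorus d))) :
        Lp ℂ 2 (volume : Measure (UnitAddTorus d))) : UnitAddTorus d → ℂ) =ᵐ[volume]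
      fun y => ∑ m ∈ S, b m * mFourier m y := by
  classical
  induction S using Finset.induction_on with
  | empty =>
      simp only [Finset.sum_empty]
      exact Lp.coeFn_zero ℂ 2 volume
  | @insert a s ha ih =>
      simp only [Finset.sum_insert ha]
      filter_upwards [Lp.coeFn_add (b a • (mFourierLp 2 a : Lp ℂ 2 (volume : Measure (UnitAddTorus d))))
        (∑ m ∈ s, b m • (mFourierLp 2 m : Lp ℂ 2 (volume : Measure (UnitAddTorus d)))),
        Lp.coeFn_smul (b a) (mFourierLp 2 a : Lp ℂ 2 (volume : Measure (UnitAddTorus d))),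
        coeFn_mFourierLp 2 a, ih] with y h1 h2 h3 h4
      rw [h1, Pi.add_apply, h2, Pi.smul_apply, h3, h4, smul_eq_mul]

/-- **Parseval for the norm**, inner-product form: `‖x‖² = ∑ₙ |⟪e_n, x⟫|²`. [cite: Grafakos2014, Prop. 3.2.7] -/
theorem hasSum_sq_norm_inner_mFourierLp (x : Lp ℂ 2 (volume : Measure (UnitAddTorus d))) :
    HasSum (fun n : d → ℤ => ‖⟪(mFourierLp 2 n : Lp ℂ 2 (volume : Measure (UnitAddTorus d))), x⟫_ℂ‖ ^ 2)
      (‖x‖ ^ 2) := by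
  have h := lp.hasSum_norm (by norm_num : 0 < (2 : ℝ≥0∞).toReal) (mFourierBasis.repr x)
  simp only [ENNReal.toReal_ofNat, Real.rpow_two, LinearIsometryEquiv.norm_map,
    HilbertBasis.repr_apply_apply, coe_mFourierBasis] at h
  exact h

/-! ## Boxes of frequencies -/

variable [DecidableEq d]

/-- Every finite set of frequencies lies in a box `[-R, R]^d`. [folklore] -/
theorem exists_subset_box (S₀ : Finset (d → ℤ)) :
    ∃ R : ℕ, S₀ ⊆ Fintype.piFinset fun _ : d => Finset.Icc (-(R : ℤ)) R := by
  classical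
  refine ⟨S₀.sup fun n => Finset.univ.sup fun i => (n i).natAbs, fun n hn => ?_⟩
  rw [Fintype.mem_piFinset]
  intro i
  have h1 : (n i).natAbs ≤ S₀.sup fun n => Finset.univ.sup fun i => (n i).natAbs :=
    (Finset.le_sup (f := fun i => (n i).natAbs) (Finset.mem_univ i)).trans
      (Finset.le_sup (f := fun n => Finset.univ.sup fun i => (n i).natAbs) hn)
  have h2 : |n i| ≤ ((S₀.sup fun n => Finset.univ.sup fun i => (n i).natAbs : ℕ) : ℤ) := by
    rw [← Int.natCast_natAbs]
    exact_mod_cast h1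
  rw [Finset.mem_Icc]
  exact abs_le.1 h2

/-- The boxes are invariant under coordinate permutations. [folklore] -/
theorem comp_perm_mem_box_iff (R : ℕ) (σ : Equiv.Perm d) (n : d → ℤ) :
    (fun i => n (σ i)) ∈ Fintype.piFinset (fun _ : d => Finset.Icc (-(R : ℤ)) R) ↔
      n ∈ Fintype.piFinset (fun _ : d => Finset.Icc (-(R : ℤ)) R) := by
  simp only [Fintype.mem_piFinset]
  exact ⟨fun h i => by simpa using h (σ.symm i), fun h i => h (σ i)⟩

/-! ## The approximation theorem -/

/-- **Bounded `L²` functions are `L²`-limits of trigonometric polynomials with controlled sup norm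
and dominated, symmetric coefficients.** For `f ∈ L²((ℝ/ℤ)^d)` with `‖f‖ ≤ C` a.e. and `ε > 0`
there are a box `B_R = [-R, R]^d` and a multiplier `m : ℤ^d → ℂ`, `|m| ≤ 1`, invariant under all
coordinate permutations, such that `P = ∑_{n ∈ B_R} m(n) f̂(n) e_n` has `|P(y)| ≤ C + ε` for every
`y` and `‖P - f‖_{L²} ≤ ε`. [cite: Grafakos2014, Thm. 3.1.6] -/
theorem exists_trigPoly_approx_of_bound (f : Lp ℂ 2 (volume : Measure (UnitAddTorus d))) {C : ℝ}
    (hC : ∀ᵐ y ∂volume, ‖f y‖ ≤ C) {ε : ℝ} (hε : 0 < ε) :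
    ∃ (R : ℕ) (m : (d → ℤ) → ℂ),
      (∀ n, ‖m n‖ ≤ 1) ∧ (∀ (σ : Equiv.Perm d) (n : d → ℤ), m (fun i => n (σ i)) = m n) ∧
      (∀ y : UnitAddTorus d, ‖∑ n ∈ Fintype.piFinset (fun _ : d => Finset.Icc (-(R : ℤ)) R),
          (m n * mFourierCoeff f n) * mFourier n y‖ ≤ C + ε) ∧
      ‖(∑ n ∈ Fintype.piFinset (fun _ : d => Finset.Icc (-(R : ℤ)) R),
          (m n * mFourierCoeff f n) • (mFourierLp 2 n : Lp ℂ 2 (volume : Measure (UnitAddTorus d)))) - f‖ ≤ ε := by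
  classical
  set c : (d → ℤ) → ℂ := fun n => mFourierCoeff f n with hc_def
  have hc2 : Summable fun n => ‖c n‖ ^ 2 := (hasSum_sq_mFourierCoeff f).summable
  -- the box kernels `K j` of radius `δ j = 1/(j+1)`
  set δ : ℕ → ℝ := fun j => 1 / ((j : ℝ) + 1) with hδ_def
  have hδpos : ∀ j, 0 < δ j := fun j => by positivity
  have hδlim : Tendsto δ atTop (𝓝 0) := tendsto_one_div_add_atTop_nhds_zero_nat
  have hδanti : ∀ {j j' : ℕ}, j ≤ j' → δ j' ≤ δ j := fun {j j'} h =>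
    one_div_le_one_div_of_le (by positivity) (by exact_mod_cast Nat.add_le_add_right h 1)
  set V : ℕ → ℝ := fun j => (volume (closedBall (0 : UnitAddTorus d) (δ j))).toReal with hV_def
  have hVpos : ∀ j, 0 < V j := fun j =>
    ENNReal.toReal_pos (measure_closedBall_pos volume _ (hδpos j)).ne' (measure_ne_top _ _)
  set K : ℕ → UnitAddTorus d → ℝ := fun j z => (V j)⁻¹ * (closedBall (0 : UnitAddTorus d) (δ j)).indicator 1 z
    with hK_def
  have hind : ∀ j z, (closedBall (0 : UnitAddTorus d) (δ j)).indicator (1 : UnitAddTorus d → ℝ) z =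
      if ‖z‖ ≤ δ j then 1 else 0 := fun j z => by
    rw [indicator_apply, mem_closedBall_zero_iff, Pi.one_apply]
  have hK0 : ∀ j z, 0 ≤ K j z := fun j z => by
    simp only [hK_def, hind]
    split_ifs <;> simp [(hVpos j).le]
  have hKm : ∀ j, Measurable (K j) := fun j =>
    measurable_const.mul (measurable_one.indicator measurableSet_closedBall)
  have hKb : ∀ j z, |K j z| ≤ (V j)⁻¹ := fun j z => by
    rw [abs_of_nonneg (hK0 j z)]
    simp only [hK_def, hind]
    split_ifs <;> simp [(hVpos j).le]
  have hK1 : ∀ j, ∫ z, K j z = 1 := fun j => by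
    simp only [hK_def]
    rw [integral_const_mul, integral_indicator_one measurableSet_closedBall, measureReal_def,
      inv_mul_cancel₀ (hVpos j).ne']
  have hKsupp : ∀ j z, δ j < ‖z‖ → K j z = 0 := fun j z hz => by
    simp only [hK_def, hind, if_neg (not_le.2 hz), mul_zero]
  have hKσ : ∀ j (σ : Equiv.Perm d) (z : UnitAddTorus d), K j (fun i => z (σ i)) = K j z := fun j σ z => by
    simp only [hK_def, hind, norm_comp_perm]
  -- the multipliers
  set m : ℕ → (d → ℤ) → ℂ := fun j n => ∫ z, (K j z : ℂ) * mFourier n z with hm_def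
  have hm1 : ∀ j n, ‖m j n‖ ≤ 1 := fun j n => norm_kernelMultiplier_le_one (hK0 j) (hK1 j) n
  have hmσ : ∀ j (σ : Equiv.Perm d) n, m j (fun i => n (σ i)) = m j n := fun j σ n =>
    kernelMultiplier_comp_perm (hKσ j σ) n
  have hmlim : ∀ n, Tendsto (fun j => m j n) atTop (𝓝 1) := by
    intro n
    rw [Metric.tendsto_atTop]
    intro ε' hε'
    obtain ⟨δ₀, hδ₀, hcont⟩ := exists_norm_mFourier_sub_one_le n (half_pos hε')
    obtain ⟨J, hJ⟩ := ((tendsto_order.1 hδlim).2 δ₀ hδ₀).exists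
    refine ⟨J, fun j hj => ?_⟩
    rw [dist_eq_norm]
    refine (norm_kernelMultiplier_sub_one_le (hK0 j) (hKm j) (hKb j) (hK1 j)
      (fun z hz => hcont z (hz.trans_lt ((hδanti hj).trans_lt hJ))) (hKsupp j)).trans_lt (half_lt_self hε')
  -- Tannery: `∑ₙ |m_j(n) - 1|² |f̂(n)|² → 0`
  have hT : Tendsto (fun j => ∑' n, ‖(m j n - 1) * c n‖ ^ 2) atTop (𝓝 0) := by
    have h := tendsto_tsum_of_dominated_convergence (𝓕 := atTop)
      (f := fun j n => ‖(m j n - 1) * c n‖ ^ 2) (g := fun _ => (0 : ℝ)) (bound := fun n => 4 * ‖c n‖ ^ 2)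
      (hc2.mul_left 4) ?_ ?_
    · simpa using h
    · intro n
      have h1 : Tendsto (fun j => (m j n - 1) * c n) atTop (𝓝 0) := by
        have := ((hmlim n).sub_const 1).mul_const (c n)
        rwa [sub_self, zero_mul] at this
      have h2 := (h1.norm).pow 2
      rwa [norm_zero, zero_pow two_ne_zero] at h2
    · refine Eventually.of_forall fun j n => ?_
      rw [Real.norm_of_nonneg (sq_nonneg _), norm_mul, mul_pow]
      have h3 : ‖m j n - 1‖ ≤ 2 := (norm_sub_le _ _).trans (by rw [norm_one]; linarith [hm1 j n])
      have h4 : ‖m j n - 1‖ ^ 2 ≤ 4 := by nlinarith [norm_nonneg (m j n - 1)]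
      exact mul_le_mul_of_nonneg_right h4 (sq_nonneg _)
  have hε8 : 0 < ε ^ 2 / 8 := by positivity
  obtain ⟨j, hj⟩ : ∃ j, ∑' n, ‖(m j n - 1) * c n‖ ^ 2 < ε ^ 2 / 8 :=
    ((tendsto_order.1 hT).2 _ hε8).exists
  -- tails beyond a finite set
  have hsumN : Summable fun n : d → ℤ => ‖m j n * c n‖ := summable_norm_kernelMultiplier_mul (hKm j) (hKb j) f
  have htail : ∀ᶠ s : Finset (d → ℤ) in atTop,
      ∑' n : {n // n ∉ s}, ‖c n‖ ^ 2 < ε ^ 2 / 8 ∧ ∑' n : {n // n ∉ s}, ‖m j n * c n‖ < ε :=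
    ((tendsto_order.1 (tendsto_tsum_compl_atTop_zero fun n : d → ℤ => ‖c n‖ ^ 2)).2 _ hε8).and
      ((tendsto_order.1 (tendsto_tsum_compl_atTop_zero fun n : d → ℤ => ‖m j n * c n‖)).2 _ hε)
  obtain ⟨S₀, hS₀⟩ := eventually_atTop.1 htail
  obtain ⟨R, hR⟩ := exists_subset_box S₀
  set S : Finset (d → ℤ) := Fintype.piFinset fun _ : d => Finset.Icc (-(R : ℤ)) R with hS_def
  obtain ⟨hS1, hS2⟩ := hS₀ S hR
  refine ⟨R, m j, hm1 j, hmσ j, fun y => ?_, ?_⟩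
  · -- the sup bound at `y`
    have hsum := hasSum_kernel_average (hKm j) (hKb j) f y
    have hsum' : HasSum (fun n : d → ℤ => (m j n * c n) * mFourier n y) (∫ z, (K j (z - y) : ℂ) * f z) :=
      hsum.congr_fun fun n => by simp only [hm_def, hc_def]; ring
    have hnormS : Summable fun n : d → ℤ => ‖(m j n * c n) * mFourier n y‖ :=
      hsumN.congr fun n => by rw [norm_mul (m j n * c n), show ‖mFourier n y‖ = 1 by simp [mFourier], mul_one]
    have hsplit := hsum'.summable.sum_add_tsum_subtype_compl S
    rw [hsum'.tsum_eq] at hsplit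
    have heq : ∑ n ∈ S, (m j n * c n) * mFourier n y =
        (∫ z, (K j (z - y) : ℂ) * f z) - ∑' n : {n // n ∉ S}, (m j n * c n) * mFourier n y := by
      rw [← hsplit, add_sub_cancel_right]
    rw [heq]
    refine (norm_sub_le _ _).trans (add_le_add (norm_integral_kernel_mul_le (hK0 j) (hKm j) (hKb j) (hK1 j) f hC y) ?_)
    refine (norm_tsum_le_tsum_norm (hnormS.subtype _)).trans ?_
    have : ∑' n : {n // n ∉ S}, ‖(m j n * c n) * mFourier n y‖ = ∑' n : {n // n ∉ S}, ‖m j n * c n‖ :=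
      tsum_congr fun n => by rw [norm_mul (m j _ * c _), show ‖mFourier (n : d → ℤ) y‖ = 1 by simp [mFourier], mul_one]
    rw [this]
    exact hS2.le
  · -- the `L²` bound
    set P : Lp ℂ 2 (volume : Measure (UnitAddTorus d)) :=
      ∑ n ∈ S, (m j n * c n) • (mFourierLp 2 n : Lp ℂ 2 (volume : Measure (UnitAddTorus d))) with hP
    have hcoef : ∀ n, ⟪(mFourierLp 2 n : Lp ℂ 2 (volume : Measure (UnitAddTorus d))), P - f⟫_ℂ =
        (if n ∈ S then m j n * c n else 0) - c n := fun n => by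
      rw [inner_sub_right, hP, inner_mFourierLp_sum_smul, inner_mFourierLp_eq_mFourierCoeff]
    have hpar := hasSum_sq_norm_inner_mFourierLp (P - f)
    simp only [hcoef] at hpar
    set g : (d → ℤ) → ℝ := fun n => ‖(if n ∈ S then m j n * c n else 0) - c n‖ ^ 2 with hg
    have hgS : ∀ n ∈ S, g n = ‖(m j n - 1) * c n‖ ^ 2 := fun n hn => by
      simp only [hg, if_pos hn]
      congr 2
      ring
    have hgSc : ∀ n ∉ S, g n = ‖c n‖ ^ 2 := fun n hn => by
      simp only [hg, if_neg hn, zero_sub, norm_neg]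
    have hsplit := hpar.summable.sum_add_tsum_subtype_compl S
    rw [hpar.tsum_eq] at hsplit
    have h1 : ∑ n ∈ S, g n ≤ ε ^ 2 / 8 := by
      rw [Finset.sum_congr rfl hgS]
      refine (Summable.sum_le_tsum S (fun n _ => sq_nonneg _) ?_).trans hj.le
      exact hc2.mul_left 4 |>.of_nonneg_of_le (fun n => sq_nonneg _) fun n => by
        rw [norm_mul, mul_pow]
        have h3 : ‖m j n - 1‖ ≤ 2 := (norm_sub_le _ _).trans (by rw [norm_one]; linarith [hm1 j n])
        have h4 : ‖m j n - 1‖ ^ 2 ≤ 4 := by nlinarith [norm_nonneg (m j n - 1)]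
        exact mul_le_mul_of_nonneg_right h4 (sq_nonneg _)
    have h2 : ∑' n : {n // n ∉ S}, g n ≤ ε ^ 2 / 8 := by
      have : ∑' n : {n // n ∉ S}, g n = ∑' n : {n // n ∉ S}, ‖c n‖ ^ 2 := tsum_congr fun n => hgSc n n.2
      rw [this]
      exact hS1.le
    have hsq : ‖P - f‖ ^ 2 ≤ ε ^ 2 := by
      rw [← hsplit]
      linarith
    exact (pow_le_pow_iff_left₀ (norm_nonneg _) hε.le two_ne_zero).1 hsq

end HaarTorus

end Literature.Analysis.FunctionSpaces

end
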